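import Summits.PneNP.PneNP.Theorems.ExpanderLinearGeneratorsLinearGeneratorModPFregeHardMod2SqComplete
import Mathlib.Data.ZMod.Basic
import HarnessLib

/-!
# `MOD₂` summation, abstract level, I: the XOR of two parities (level induction)

Support file for item `stmt-PneNP-11444` (`LinearGeneratorModPFregeHard`), calibration line "for
`p = 2` the rung fails: `MOD₂` gates sum the certificate rows in polynomial size".  The summation
proof is built in `textbookFrege` over the `¬∧∨`-language in which every `MOD₂` subformula
`MOD_{2,c}(y₀, …, y_{k-1})` of *kind* `κ` (a row of the system, or an accumulated symmetric
difference of rows) is the ATOM `var (zv c k κ)`; `yⱼ` is `var j` if `j` belongs to the set of kind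
`κ` and `⊥` otherwise (`Y j κ`).  The `MOD₂` axioms of Buss et al. (Def. 1.1) become the skeleton
hypotheses `H3 c k κ : Z(c,k+1,κ) ≡ (Z(c,k,κ) ∧ ¬y_k) ∨ (Z(c-1,k,κ) ∧ y_k)` (and `Z(0,0,κ)`,
`¬Z(1,0,κ)`), whose NEGATIONS sit in the context `K` of every sequent; a later file substitutes the
`MOD₂` formulas back and turns the hypotheses into axioms (`…Mod2Transfer.lean`).

This file: for kinds `κD, κS, κE` whose sets satisfy `E = D ∆ S` (hypothesis `hYE`, read
semantically), the level-`k` fact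
`Φ k = ⋀_{u,v ∈ {0,1}} (¬Z(u,k,κD) ∨ ¬Z(v,k,κS) ∨ Z(u+v,k,κE))`
is derived for all `k ≤ n` by ONE chained induction (`sq_xor_level`: `Φ (k+1)` follows from `Φ k`
and six skeleton hypotheses by a constant-size tautology, `xor_step_bool`, discharged by
`sq_step`), in `O(k)` ticks; and `sq_xor_combine` concludes `Z(c+b,n,κE)` from `Z(c,n,κD)` and
`Z(b,n,κS)`.  All objects are section variables with defining hypotheses (no definitions), to be
instantiated in the assembly file.

Sources: S. Buss, R. Impagliazzo, J. Krajíček, P. Pudlák, A. A. Razborov, J. Sgall, *Proof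
complexity in algebraic systems and bounded depth Frege systems with modular counting*, Comput.
Complexity 6 (1996/97), Def. 1.1 (the `MOD_a` axioms); the summation argument is the folklore
remark recorded in the item's docstring ("`MOD₂` gates sum the certificate rows").
-/

set_option linter.dupNamespace false -- `Summit.PneNP.PneNP.…`: summit = sub-problem (D-0017)

namespace Summit.PneNP.PneNP.Theorems.ModTwo

open Literature.Computability.Complexity Literature.Computability.Complexity.PropForm
open Literature.Computability.MetaComplexity Literature.Computability.MetaComplexity.DepthFrege
open Literature.Computability.MetaComplexity.TextbookFrege (disjList disjList_nil disjList_cons)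

/-! ### The Boolean core of one level step -/

/-- One level of the XOR induction, as a Boolean identity: if the six new parity atoms unfold by
the `MOD₂` recursion (`x' = (x ∧ ¬y) ∨ (x⁻ ∧ y)`) with `y_E = y_D ⊕ y_S`, then the four XOR
clauses at level `k` imply the four at level `k+1`. [folklore] -/
theorem xor_step_bool :
    ∀ (yD yS d0 d1 s0 s1 e0 e1 d0' d1' s0' s1' e0' e1' : Bool),
      (d0' == (d0 && !yD || d1 && yD)) = true → (d1' == (d1 && !yD || d0 && yD)) = true →
      (s0' == (s0 && !yS || s1 && yS)) = true → (s1' == (s1 && !yS || s0 && yS)) = true →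
      (e0' == (e0 && !(xor yD yS) || e1 && (xor yD yS))) = true →
      (e1' == (e1 && !(xor yD yS) || e0 && (xor yD yS))) = true →
      ((!d0 || (!s0 || e0)) && ((!d0 || (!s1 || e1)) && ((!d1 || (!s0 || e1)) &&
        (!d1 || (!s1 || e0))))) = true →
      ((!d0' || (!s0' || e0')) && ((!d0' || (!s1' || e1')) && ((!d1' || (!s0' || e1')) &&
        (!d1' || (!s1' || e0'))))) = true := by
  decide

section Xor

variable {Q : SPrm} (zv : ZMod 2 → ℕ → ℕ → ℕ) (Y : ℕ → ℕ → PropForm ℕ)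
  (H3 : ZMod 2 → ℕ → ℕ → PropForm ℕ) (Φ : ℕ → PropForm ℕ) (κD κS κE n : ℕ)
  (K : List (PropForm ℕ))

/-! ### Syntactic facts about the skeleton formulas -/

/-- Size of the parity arguments `y_j` (a variable or `⊥`). [folklore] -/
theorem size_Y (hY : ∀ k κ, Y k κ = var k ∨ Y k κ = const false) (k κ : ℕ) : (Y k κ).size = 1 := by
  rcases hY k κ with h | h <;> rw [h] <;> rfl

/-- Depth of the parity arguments `y_j`. [folklore] -/
theorem altDepthAux_Y (hY : ∀ k κ, Y k κ = var k ∨ Y k κ = const false) (c k κ : ℕ) :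
    altDepthAux c (Y k κ) = 0 := by
  rcases hY k κ with h | h <;> rw [h] <;> rfl

/-- Size and depth of the skeleton of `MOD₂` axiom 3 and of its negation. [folklore] -/
theorem bounds_H3 (hY : ∀ k κ, Y k κ = var k ∨ Y k κ = const false) {c c' : ZMod 2} {k κ : ℕ}
    {X : PropForm ℕ}
    (hX : X = PropForm.biimp (var (zv c (k + 1) κ))
      (disj (conj (var (zv c k κ)) (neg (Y k κ))) (conj (var (zv c' k κ)) (Y k κ)))) :
    X.size = 23 ∧ (neg X).size = 24 ∧ X.altDepth ≤ 6 ∧ (neg X).altDepth ≤ 7 := by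
  subst hX
  refine ⟨?_, ?_, ?_, ?_⟩
  · simp [PropForm.biimp, size, size_Y Y hY]
  · simp [PropForm.biimp, size, size_Y Y hY]
  · simp [PropForm.biimp, altDepth, altDepthAux, altDepthAux_Y Y hY]
  · simp [PropForm.biimp, altDepth, altDepthAux, altDepthAux_Y Y hY]

/-- Size and depth of the level fact `Φ k` and of its negation. [folklore] -/
theorem bounds_Phi {X : PropForm ℕ} {a1 a2 a3 b1 b2 b3 c1 c2 c3 d1 d2 d3 : ℕ}
    (hX : X = conj (disj (neg (var a1)) (disj (neg (var a2)) (var a3)))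
      (conj (disj (neg (var b1)) (disj (neg (var b2)) (var b3)))
        (conj (disj (neg (var c1)) (disj (neg (var c2)) (var c3)))
          (disj (neg (var d1)) (disj (neg (var d2)) (var d3)))))) :
    X.size = 31 ∧ (neg X).size = 32 ∧ X.altDepth = 3 ∧ (neg X).altDepth = 4 := by
  subst hX
  simp [size, altDepth, altDepthAux]

/-- A formula of depth `≤ 8` and size `≤ 40` is a base formula once `D ≥ 8`, `M ≥ 40`. [folklore] -/
theorem base_of_bounds (hQ : 8 ≤ Q.D ∧ 40 ≤ Q.M) {X : PropForm ℕ} (hd : X.altDepth ≤ 8)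
    (hs : X.size ≤ 40) : Base Q X :=
  ⟨hd.trans hQ.1, hs.trans hQ.2⟩

/-! ### The level induction -/

/-- **XOR of two parities, level by level.** In a context `K` containing the negated skeleton
hypotheses `¬H3(c,k,κ)` for `κ ∈ {κD, κS, κE}`, `k < n`, together with `¬Z(0,0,κE)` and
`¬¬Z(1,0,κD)`, `¬¬Z(1,0,κS)` (negations of axioms 1, 2), and with `y_E = y_D ⊕ y_S` at every
level, the fact `Φ k` (the four XOR clauses at level `k`) satisfies
`Sq Q ((2^(N+2)+2)·(k+1)) (Φ k :: K)` for every `k ≤ n`. [Buss et al. 1997, Def. 1.1] [folklore] -/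
theorem sq_xor_level
    (hH3₀ : ∀ k κ, H3 0 k κ = PropForm.biimp (var (zv 0 (k + 1) κ))
      (disj (conj (var (zv 0 k κ)) (neg (Y k κ))) (conj (var (zv 1 k κ)) (Y k κ))))
    (hH3₁ : ∀ k κ, H3 1 k κ = PropForm.biimp (var (zv 1 (k + 1) κ))
      (disj (conj (var (zv 1 k κ)) (neg (Y k κ))) (conj (var (zv 0 k κ)) (Y k κ))))
    (hΦ : ∀ k, Φ k =
      conj (disj (neg (var (zv 0 k κD))) (disj (neg (var (zv 0 k κS))) (var (zv 0 k κE))))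
      (conj (disj (neg (var (zv 0 k κD))) (disj (neg (var (zv 1 k κS))) (var (zv 1 k κE))))
      (conj (disj (neg (var (zv 1 k κD))) (disj (neg (var (zv 0 k κS))) (var (zv 1 k κE))))
      (disj (neg (var (zv 1 k κD))) (disj (neg (var (zv 1 k κS))) (var (zv 0 k κE)))))))
    (hY : ∀ k κ, Y k κ = var k ∨ Y k κ = const false)
    (hYE : ∀ k (τ : ℕ → Bool), k < n →
      (Y k κE).eval τ = xor ((Y k κD).eval τ) ((Y k κS).eval τ))
    (hKb : ∀ A ∈ K, Base Q A) (hQ : 8 ≤ Q.D ∧ 40 ≤ Q.M)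
    (hK3 : ∀ (c : ZMod 2) (k : ℕ), k < n →
      neg (H3 c k κD) ∈ K ∧ neg (H3 c k κS) ∈ K ∧ neg (H3 c k κE) ∈ K)
    (hK1 : neg (var (zv 0 0 κE)) ∈ K)
    (hK2 : neg (neg (var (zv 1 0 κD))) ∈ K ∧ neg (neg (var (zv 1 0 κS))) ∈ K)
    {N : ℕ} (hN : 6000 ≤ N) (hW : K.length + N + 12 ≤ Q.W) :
    ∀ k, k ≤ n → Sq Q ((2 ^ (N + 2) + 2) * (k + 1)) (Φ k :: K) := by
  have hΦb : ∀ k, (Φ k).size = 31 ∧ (neg (Φ k)).size = 32 ∧ (Φ k).altDepth = 3 ∧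
      (neg (Φ k)).altDepth = 4 := fun k => bounds_Phi (hΦ k)
  have hc2 : ∀ c : ZMod 2, c = 0 ∨ c = 1 := by decide
  have hH3b : ∀ (c : ZMod 2) k κ, (H3 c k κ).size = 23 ∧ (neg (H3 c k κ)).size = 24 ∧
      (H3 c k κ).altDepth ≤ 6 ∧ (neg (H3 c k κ)).altDepth ≤ 7 := by
    intro c k κ
    obtain rfl | rfl := hc2 c
    · exact bounds_H3 zv Y hY (hH3₀ k κ)
    · exact bounds_H3 zv Y hY (hH3₁ k κ)
  have hΦbase : ∀ k, Base Q (Φ k) := fun k =>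
    base_of_bounds hQ (by rw [(hΦb k).2.2.1]; norm_num) (by rw [(hΦb k).1]; norm_num)
  intro k
  induction k with
  | zero =>
    intro _
    have h := sq_step (Q := Q) (K := K) (Fs := []) (t := 0) (N := N)
      (Cs := [neg (var (zv 0 0 κE)), neg (neg (var (zv 1 0 κD))), neg (neg (var (zv 1 0 κS)))])
      (G := Φ 0) (by simp)
      (by
        intro C hC
        simp only [List.mem_cons, List.not_mem_nil, or_false] at hC
        rcases hC with rfl | rfl | rfl
        · exact hK1
        · exact hK2.1
        · exact hK2.2)
      hKb (hΦbase 0) (by simp)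
      (by norm_num [size, (hΦb 0).1]; omega)
      (by simp; omega)
      (by
        intro τ _ hC
        have c1 := hC (neg (var (zv 0 0 κE))) (by simp)
        have c2 := hC (neg (neg (var (zv 1 0 κD)))) (by simp)
        have c3 := hC (neg (neg (var (zv 1 0 κS)))) (by simp)
        simp only [eval, Bool.not_eq_false', Bool.not_not] at c1 c2 c3
        rw [hΦ]
        simp [eval, c1, c2, c3])
    exact h.mono (by simp)
  | succ k ih =>
    intro hk
    have hk' : k < n := Nat.lt_of_succ_le hk
    have ihk := ih hk'.le
    have h := sq_step (Q := Q) (K := K) (Fs := [Φ k]) (t := (2 ^ (N + 2) + 2) * (k + 1)) (N := N)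
      (Cs := [neg (H3 0 k κD), neg (H3 1 k κD), neg (H3 0 k κS), neg (H3 1 k κS),
        neg (H3 0 k κE), neg (H3 1 k κE)])
      (G := Φ (k + 1)) (by simpa using ihk)
      (by
        intro C hC
        simp only [List.mem_cons, List.not_mem_nil, or_false] at hC
        rcases hC with rfl | rfl | rfl | rfl | rfl | rfl
        · exact (hK3 0 k hk').1
        · exact (hK3 1 k hk').1
        · exact (hK3 0 k hk').2.1
        · exact (hK3 1 k hk').2.1
        · exact (hK3 0 k hk').2.2
        · exact (hK3 1 k hk').2.2)
      hKb (hΦbase (k + 1))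
      (by
        intro F hF
        rw [List.mem_singleton] at hF
        subst hF
        exact base_of_bounds hQ (by rw [(hΦb k).2.2.2]; norm_num) (by rw [(hΦb k).2.1]; norm_num))
      (by
        simp only [List.map_cons, List.map_nil, List.cons_append, List.nil_append, List.sum_cons,
          List.sum_nil, (hΦb k).2.1, (hΦb (k + 1)).1, (hH3b 0 k κD).2.1, (hH3b 1 k κD).2.1,
          (hH3b 0 k κS).2.1, (hH3b 1 k κS).2.1, (hH3b 0 k κE).2.1, (hH3b 1 k κE).2.1]
        omega)
      (by simp; omega)
      (by
        intro τ hF hC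
        have f := hF (Φ k) (by simp)
        have c1 := hC (neg (H3 0 k κD)) (by simp)
        have c2 := hC (neg (H3 1 k κD)) (by simp)
        have c3 := hC (neg (H3 0 k κS)) (by simp)
        have c4 := hC (neg (H3 1 k κS)) (by simp)
        have c5 := hC (neg (H3 0 k κE)) (by simp)
        have c6 := hC (neg (H3 1 k κE)) (by simp)
        rw [hΦ] at f ⊢
        rw [hH3₀] at c1 c3 c5
        rw [hH3₁] at c2 c4 c6
        simp only [eval, eval_biimp, Bool.not_eq_false'] at f c1 c2 c3 c4 c5 c6 ⊢
        rw [hYE k τ hk'] at c5 c6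
        exact xor_step_bool _ _ _ _ _ _ _ _ _ _ _ _ _ _ c1 c2 c3 c4 c5 c6 f)
    refine h.mono ?_
    simp only [List.length_singleton]
    ring_nf
    omega

/-- **Combining two parities at full length.** Under the hypotheses of `sq_xor_level`, from
`⊢ Z(c,n,κD), K` and `⊢ Z(b,n,κS), K` (both within `t` ticks) infer `⊢ Z(c+b,n,κE), K` within
`2^(N+2) + 3·(max t ((2^(N+2)+2)(n+1)) + 2)` ticks. [Buss et al. 1997, Def. 1.1] [folklore] -/
theorem sq_xor_combine
    (hH3₀ : ∀ k κ, H3 0 k κ = PropForm.biimp (var (zv 0 (k + 1) κ))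
      (disj (conj (var (zv 0 k κ)) (neg (Y k κ))) (conj (var (zv 1 k κ)) (Y k κ))))
    (hH3₁ : ∀ k κ, H3 1 k κ = PropForm.biimp (var (zv 1 (k + 1) κ))
      (disj (conj (var (zv 1 k κ)) (neg (Y k κ))) (conj (var (zv 0 k κ)) (Y k κ))))
    (hΦ : ∀ k, Φ k =
      conj (disj (neg (var (zv 0 k κD))) (disj (neg (var (zv 0 k κS))) (var (zv 0 k κE))))
      (conj (disj (neg (var (zv 0 k κD))) (disj (neg (var (zv 1 k κS))) (var (zv 1 k κE))))
      (conj (disj (neg (var (zv 1 k κD))) (disj (neg (var (zv 0 k κS))) (var (zv 1 k κE))))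
      (disj (neg (var (zv 1 k κD))) (disj (neg (var (zv 1 k κS))) (var (zv 0 k κE)))))))
    (hY : ∀ k κ, Y k κ = var k ∨ Y k κ = const false)
    (hYE : ∀ k (τ : ℕ → Bool), k < n →
      (Y k κE).eval τ = xor ((Y k κD).eval τ) ((Y k κS).eval τ))
    (hKb : ∀ A ∈ K, Base Q A) (hQ : 8 ≤ Q.D ∧ 40 ≤ Q.M)
    (hK3 : ∀ (c : ZMod 2) (k : ℕ), k < n →
      neg (H3 c k κD) ∈ K ∧ neg (H3 c k κS) ∈ K ∧ neg (H3 c k κE) ∈ K)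
    (hK1 : neg (var (zv 0 0 κE)) ∈ K)
    (hK2 : neg (neg (var (zv 1 0 κD))) ∈ K ∧ neg (neg (var (zv 1 0 κS))) ∈ K)
    {N : ℕ} (hN : 6000 ≤ N) (hW : K.length + N + 12 ≤ Q.W)
    {t : ℕ} {c b : ZMod 2} (hDf : Sq Q t (var (zv c n κD) :: K))
    (hSf : Sq Q t (var (zv b n κS) :: K)) :
    Sq Q (2 ^ (N + 2) + 3 * (max t ((2 ^ (N + 2) + 2) * (n + 1)) + 2))
      (var (zv (c + b) n κE) :: K) := by
  have hlev := sq_xor_level zv Y H3 Φ κD κS κE n K hH3₀ hH3₁ hΦ hY hYE hKb hQ hK3 hK1 hK2 hN hW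
    n le_rfl
  have hΦb := bounds_Phi (hΦ n)
  set t' := max t ((2 ^ (N + 2) + 2) * (n + 1)) with ht'
  have hvb : ∀ v, Base Q (var v) := fun v =>
    base_of_bounds hQ (by simp [altDepth, altDepthAux]) (by simp [size])
  have h := sq_step (Q := Q) (K := K) (Fs := [Φ n, var (zv c n κD), var (zv b n κS)]) (t := t')
    (N := N) (Cs := []) (G := var (zv (c + b) n κE))
    (by
      intro F hF
      simp only [List.mem_cons, List.not_mem_nil, or_false] at hF
      rcases hF with rfl | rfl | rfl
      · exact hlev.mono (le_max_right _ _)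
      · exact hDf.mono (le_max_left _ _)
      · exact hSf.mono (le_max_left _ _))
    (by simp) hKb (hvb _)
    (by
      intro F hF
      simp only [List.mem_cons, List.not_mem_nil, or_false] at hF
      rcases hF with rfl | rfl | rfl
      · exact base_of_bounds hQ (by rw [hΦb.2.2.2]; norm_num) (by rw [hΦb.2.1]; norm_num)
      · exact base_of_bounds hQ (by simp [altDepth, altDepthAux]) (by simp [size])
      · exact base_of_bounds hQ (by simp [altDepth, altDepthAux]) (by simp [size]))
    (by
      norm_num [hΦb.1, size]
      omega)
    (by simp; omega)
    (by
      intro τ hF _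
      have f := hF (Φ n) (by simp)
      have fD := hF (var (zv c n κD)) (by simp)
      have fS := hF (var (zv b n κS)) (by simp)
      rw [hΦ] at f
      simp only [eval] at f fD fS ⊢
      have hc2 : ∀ c : ZMod 2, c = 0 ∨ c = 1 := by decide
      obtain rfl | rfl := hc2 c
      · obtain rfl | rfl := hc2 b
        · simp only [fD, fS, Bool.not_true, Bool.false_or, Bool.and_eq_true] at f
          simpa using f.1
        · simp only [fD, fS, Bool.not_true, Bool.false_or, Bool.and_eq_true] at f
          simpa using f.2.1
      · obtain rfl | rfl := hc2 b
        · simp only [fD, fS, Bool.not_true, Bool.false_or, Bool.and_eq_true] at f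
          simpa using f.2.2.1
        · simp only [fD, fS, Bool.not_true, Bool.false_or, Bool.and_eq_true] at f
          have e : (1 : ZMod 2) + 1 = 0 := by decide
          simpa [e] using f.2.2.2)
  exact h.mono (by simp)

end Xor

end Summit.PneNP.PneNP.Theorems.ModTwo
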